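import Summits.HodgeConjecture.HodgeConjecture.Theorems.Ring2HypothesesMultiWeilVsPullbacks
import Summits.HodgeConjecture.HodgeConjecture.Theorems.Ring2ClassTargetsWeilPullbackGenerated
import HarnessLib

/-!
# Part XIX-B — (G) against `IsWeilPullbackGenerated` BY NAME (research route conditional on HC_CM; not a corollary; Q11.4-sentence-2 already refuted in dim ≥ 3)

Typer 2 (hypotheses layer). Part XIX (`Ring2HypothesesMultiWeilVsPullbacks`, p194823) compared part XIV's member
shape (G) `IsDivisorMultiWeilGenerated A` with typer 1's pull-back shape (P) with (P)'s two clauses WRITTEN OUT,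
because `Ring2ClassTargetsWeilPullbackGenerated` (typer 1, p194357: `IsCodimTwoGeneratedBy`,
`IsCodimThreeProductGenerated`, `IsWeilPullbackGenerated`) had no olean at the time. This file re-points the
deciding rows to the NAMES; every proof is part XIX's theorem up to definitional unfolding, no new mathematics.

Rows: (1) `B = D ⟹ (P)`; (2) SIXFOLDS `B = D ⟺ (G) ∧ IsWeilPullbackGenerated` (the shapes are transverse);
(3) odd dimension and row `7`: (G) ⟹ `IsWeilPullbackGenerated`; (4) (O1) a (G)-sixfold with one rational `(3,3)`
class outside `D³ ⊗ ℂ` violates `IsCodimThreeProductGenerated`, hence `IsWeilPullbackGenerated`; from Weil's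
barrier fact a sixfold violating `(G) ∧ IsCodimThreeProductGenerated` exists; (5) (G) off dimension `4` gives
`IsCodimTwoGeneratedBy A S` for every seed set; (6) `IsCodimThreeProductGenerated` on every 6- and 7-fold ⟹ X1
(`Theses.SevenfoldWeilCensus.CodimThreeWeilGeneration`, BY NAME, hypothesis not asserted).

HONEST STATUS. `HC_CM` (`Theses.RankFourFaces.CMAbelianHodge`) does not occur. (G), (P) and `B = D` are
HYPOTHESES on a member (census / cell computations), never asserted. Nothing here decides HC of any cell.
-/

set_option linter.dupNamespace false

open CategoryTheory
open Literature.AlgebraicGeometry Literature.AlgebraicGeometry.Motives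
open Literature.AlgebraicGeometry.HodgeTheory
open Literature.AlgebraicTopology.SingularHomology
open Literature.Barriers.HodgeConjecture (divisorClassesSpan Weil1977_exceptionalHodgeClasses)
open Summit.HodgeConjecture.HodgeConjecture.Theses
open Summit.HodgeConjecture.HodgeConjecture.Ring2.ClassTargets

namespace Summit.HodgeConjecture.HodgeConjecture.Ring2.Hypotheses

/-- **`B = D ⟹ IsWeilPullbackGenerated A`.** [cite: vanGeemen1994HodgeAV, §2.4–2.5] -/
theorem isWeilPullbackGenerated_of_isDivisorGenerated {A : AbelianVariety ℂ} (h : IsDivisorGenerated A) :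
    IsWeilPullbackGenerated A :=
  ⟨codimTwoGeneratedBy_of_isDivisorGenerated h _, productClause_of_isDivisorGenerated h⟩

/-- **(G) off dimension `4` ⟹ `IsCodimTwoGeneratedBy A S` for every seed set `S`.**
[cite: vanGeemen1994HodgeAV, 4.9] [cite: MoonenZarhin1999LowDim, Thm. 0.2 (e),(f)] -/
theorem isCodimTwoGeneratedBy_of_isDivisorMultiWeilGenerated_of_dim_ne {A : AbelianVariety ℂ}
    (hA : A.dim ≠ 2 * 2) (hG : IsDivisorMultiWeilGenerated A) (S : Set (complexBetti A.X (2 * 2))) :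
    IsCodimTwoGeneratedBy A S :=
  codimTwoGeneratedBy_of_isDivisorMultiWeilGenerated_of_dim_ne hA hG S

/-- **SIXFOLDS: (G) ∧ `IsWeilPullbackGenerated` ⟹ `B = D`.** [cite: vanGeemen1994HodgeAV, §2.4–2.5 and 4.9]
[cite: MoonenZarhin1999LowDim, §5] -/
theorem isDivisorGenerated_of_multiWeil_of_isWeilPullbackGenerated_six {A : AbelianVariety ℂ} (hA : A.dim = 6)
    (hG : IsDivisorMultiWeilGenerated A) (hP : IsWeilPullbackGenerated A) : IsDivisorGenerated A :=
  isDivisorGenerated_of_multiWeil_of_productClause_six hA hG hP.2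

/-- **SIXFOLDS: `B = D ⟺ (G) ∧ IsWeilPullbackGenerated`** — the two member shapes are TRANSVERSE.
[cite: vanGeemen1994HodgeAV, §2.4–2.5 and Thm. 6.12] [cite: MoonenZarhin1999LowDim, Thm. 0.2 (e),(f) and §5]
[cite: Andre1992HodgeCM, Théorème] -/
theorem isDivisorGenerated_iff_multiWeil_and_isWeilPullbackGenerated_six {A : AbelianVariety ℂ}
    (hA : A.dim = 6) : IsDivisorGenerated A ↔ IsDivisorMultiWeilGenerated A ∧ IsWeilPullbackGenerated A :=
  ⟨fun h ↦ ⟨isDivisorMultiWeilGenerated_of_isDivisorGenerated h, isWeilPullbackGenerated_of_isDivisorGenerated h⟩,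
    fun h ↦ isDivisorGenerated_of_multiWeil_of_isWeilPullbackGenerated_six hA h.1 h.2⟩

/-- **Where both shapes hold on a sixfold, HC is FREE** (no `W₆`, no floor, no R3, no `HC_CM`).
[cite: vanGeemen1994HodgeAV, §2.4] [cite: VoisinHodgeI2002, Thm. 11.30] -/
theorem hodgeConjectureFor_of_multiWeil_of_isWeilPullbackGenerated_six {A : AbelianVariety ℂ} (hA : A.dim = 6)
    (hG : IsDivisorMultiWeilGenerated A) (hP : IsWeilPullbackGenerated A) : HodgeConjectureFor A.dim A.X :=
  hodgeConjectureFor_of_isDivisorGenerated A (isDivisorGenerated_of_multiWeil_of_isWeilPullbackGenerated_six hA hG hP)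

/-- **Odd dimension: (G) ⟹ `IsWeilPullbackGenerated`** ((G) is `B = D` there). The converse is not claimed.
[cite: vanGeemen1994HodgeAV, 4.9] [cite: MoonenZarhin1999LowDim, §3 (3.8) and §5] -/
theorem isWeilPullbackGenerated_of_isDivisorMultiWeilGenerated_of_odd_dim {A : AbelianVariety ℂ}
    (hA : Odd A.dim) (hG : IsDivisorMultiWeilGenerated A) : IsWeilPullbackGenerated A :=
  pullbackShape_of_isDivisorMultiWeilGenerated_of_odd_dim hA hG

/-- **Row `7`: (G) ⟹ `IsWeilPullbackGenerated`.** [cite: vanGeemen1994HodgeAV, 4.9] [cite: MoonenZarhin1999LowDim, §5] -/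
theorem isWeilPullbackGenerated_of_isDivisorMultiWeilGenerated_seven {A : AbelianVariety ℂ} (hA : A.dim = 7)
    (hG : IsDivisorMultiWeilGenerated A) : IsWeilPullbackGenerated A :=
  pullbackShape_of_isDivisorMultiWeilGenerated_seven hA hG

/-- **(O1) by name: a (G)-sixfold with ONE rational `(3,3)` class outside `D³ ⊗ ℂ` violates
`IsCodimThreeProductGenerated`.** [cite: vanGeemen1994HodgeAV, Thm. 6.12 and Thm. 4.11] [cite: Weil1977HodgeRing] -/
theorem not_isCodimThreeProductGenerated_of_isDivisorMultiWeilGenerated_of_exceptional_three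
    {A : AbelianVariety ℂ} (hA : A.dim = 6) (hG : IsDivisorMultiWeilGenerated A) {c : complexBetti A.X (2 * 3)}
    (hc : IsRationalClass c) (hH : IsOfHodgeType A.dim A.X (2 * 3) 3 3 c)
    (hn : c ∉ divisorClassesSpan A.X A.dim 3) : ¬ IsCodimThreeProductGenerated A :=
  not_productClause_of_isDivisorMultiWeilGenerated_of_exceptional_three hA hG hc hH hn

/-- **(O1) by name, for the conjunction shape.** [cite: vanGeemen1994HodgeAV, Thm. 6.12] -/
theorem not_isWeilPullbackGenerated_of_isDivisorMultiWeilGenerated_of_exceptional_three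
    {A : AbelianVariety ℂ} (hA : A.dim = 6) (hG : IsDivisorMultiWeilGenerated A) {c : complexBetti A.X (2 * 3)}
    (hc : IsRationalClass c) (hH : IsOfHodgeType A.dim A.X (2 * 3) 3 3 c)
    (hn : c ∉ divisorClassesSpan A.X A.dim 3) : ¬ IsWeilPullbackGenerated A :=
  fun hP ↦ not_productClause_of_isDivisorMultiWeilGenerated_of_exceptional_three hA hG hc hH hn hP.2

/-- **(O1) in the kernel from Weil's barrier fact (`n = 3`)**: a sixfold violating
`(G) ∧ IsCodimThreeProductGenerated`. [cite: vanGeemen1994HodgeAV, Thm. 4.11 and Thm. 6.12] [cite: Weil1977HodgeRing] -/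
theorem exists_six_not_multiWeil_and_isCodimThreeProductGenerated_of_weil1977
    (h : Weil1977_exceptionalHodgeClasses) :
    ∃ A : AbelianVariety ℂ, A.dim = 6 ∧ ¬ (IsDivisorMultiWeilGenerated A ∧ IsCodimThreeProductGenerated A) :=
  exists_six_not_multiWeil_and_productClause_of_weil1977 h

/-- **(O2) by name: `IsWeilPullbackGenerated` does not rescue (G)** — one rational `(2,2)` class outside `D² ⊗ ℂ`
on a 6- or 7-fold kills (G) whatever else holds (members: the K3-partner sixfolds, cell computation K3-WP).
[cite: MoonenZarhin1999LowDim, Thm. 0.2 (e),(f) and §5] -/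
theorem not_isDivisorMultiWeilGenerated_of_isWeilPullbackGenerated_of_exceptional_two {A : AbelianVariety ℂ}
    (hA : A.dim = 6 ∨ A.dim = 7) (_hP : IsWeilPullbackGenerated A) {c : complexBetti A.X (2 * 2)}
    (hc : IsRationalClass c) (hH : IsOfHodgeType A.dim A.X (2 * 2) 2 2 c)
    (hn : c ∉ divisorClassesSpan A.X A.dim 2) : ¬ IsDivisorMultiWeilGenerated A :=
  not_isDivisorMultiWeilGenerated_of_exceptional_two hA hc hH hn

/-- **`IsCodimThreeProductGenerated` on every 6- and 7-fold ⟹ X1** (route item stmt-18720 BY NAME; the hypothesis is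
NOT asserted — it fails at `E × Y₆`, table XIX.2 of the map). [cite: MoonenZarhin1999LowDim, (2.7)–(2.8) and §5] -/
theorem codimThreeWeilGeneration_of_forall_isCodimThreeProductGenerated
    (h : ∀ A : AbelianVariety ℂ, A.dim = 6 ∨ A.dim = 7 → IsCodimThreeProductGenerated A) :
    SevenfoldWeilCensus.CodimThreeWeilGeneration :=
  codimThreeWeilGeneration_of_forall_productClause h

-- Audit under `HodgeConjecture`: part XIX's `multiWeilVsPullbacks_audit_of_hodgeConjecture` (reused, not restated).

end Summit.HodgeConjecture.HodgeConjecture.Ring2.Hypotheses
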